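import Summits.FinalStateConjecture.FinalStateConjecture.Theses.ExactKerrEnds
import Summits.FinalStateConjecture.FinalStateConjecture.Theses.TangentProfileCensorship
import Summits.FinalStateConjecture.FinalStateConjecture.Theses.CurvatureOrSymmetry
import Literature.Geometry.Lorentzian.TameBreathingCurve
import Literature.Geometry.Lorentzian.CauchyDevelopmentPrecomp
import Literature.Geometry.Lorentzian.ExactKerrEnd
import Literature.Geometry.Lorentzian.KerrDataProofs
import Literature.Geometry.Lorentzian.KerrSchildCoord
import Summits.FinalStateConjecture.FinalStateConjecture.Theorems.ExactKerrEndsCensorshipAlongKerrEndsWindowUpgrade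
import Summits.FinalStateConjecture.FinalStateConjecture.Theorems.ExactKerrEndsCensorshipAlongKerrEndsSettledBreathing
import Summits.FinalStateConjecture.FinalStateConjecture.Theorems.ExactKerrEndsTrivialDatumWitness
import Summits.FinalStateConjecture.FinalStateConjecture.Theorems.ExactKerrEndsTameEscapeToKerrEndsChartKerrEnd
import Summits.FinalStateConjecture.FinalStateConjecture.Theorems.SwallowTheDatumParametricKerrBurialLine
import Summits.FinalStateConjecture.FinalStateConjecture.Theorems.ExactKerrEndsTameEscapeToKerrEndsMinkowskiLeaf
import Summits.FinalStateConjecture.FinalStateConjecture.Theorems.ExactKerrEndsCensorshipAlongKerrEndsMinkowskiCensored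
import Summits.FinalStateConjecture.FinalStateConjecture.Theorems.ExactKerrEndsCensorshipAlongKerrEndsRecedingSelection
import Summits.FinalStateConjecture.FinalStateConjecture.Theorems.ExactKerrEndsCensorshipAlongKerrEndsDefs
import Summits.FinalStateConjecture.FinalStateConjecture.Theorems.ExactKerrEndsCensorshipAlongKerrEndsCompactSettledBreathing
import Summits.FinalStateConjecture.FinalStateConjecture.Theorems.ExactKerrEndsCensorshipAlongKerrEndsRadialOfCurve
import Summits.FinalStateConjecture.FinalStateConjecture.Theorems.ExactKerrEndsCensorshipAlongKerrEndsPatchAlongCompactFamily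
import Literature.Geometry.Lorentzian.TameGaugedFamily
import Literature.Geometry.Lorentzian.TameFamilyOffCompact

/-!
# Line `Sketch` (idea `transplant-the-end`) — crux `CensorshipAlongKerrEnds` (stmt-FinalStateConjecture-18521,
# route ExactKerrEnds, rank 3; decl `Summit.FinalStateConjecture.FinalStateConjecture.Theses.ExactKerrEnds.CensorshipAlongKerrEnds`)
# — LEAD SKELETON v4.2 (continuation lead prover-line-stmt-FinalStateConjecture-18521-c4-0, 2026-08-17T15:30Z;
# v3.3 by lead c1, v3.4/v3.5/v3.6 by lead c3 — the v3.5 composition is LANDED, p160948)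

## v4 (this lead): the COMPACT-SUPPORT ARCHITECTURE (lead c3's "structural observation", Lines/Sketch.md §3, made
## into the registered stub set). The parametric solution map disappears from the crux. v4.2: the two physics exits are
## asked in the WEAKEST witness form (smooth compactly supported deformations; tameness automatic, immersion gauge-borne).

v3.5 reduced `C₁` to two private stubs: `stub_gluingAlongFamily` (matched exterior Kerr gluing run ALONG an
arbitrary tame family `G`, jointly smooth in `(c, R, x)` — i.e. the sibling crux E's analytic atom PLUS an
unprinted smooth-dependence-on-the-datum statement PLUS uniformity in `c`) and `stub_reEndingAbsorption` (open
physics). Nobody will prove the first independently of E, and even E's closure would not close it (E's line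
works on the FIXED-DATUM atom S1♭♭ ⟹ S1♭, `Theorems/ExactKerrEndsTameEscapeToKerrEnds{UnitCurve,GluingCurve}.lean`).

Observation (c3): if the settled access family `G` through the base `d = F 0` is COMPACTLY SUPPORTED (`G c = d` off
one compact `K₀`, all `c`) then the glued two-parameter family is obtained from ONE receding glued family
`Ĝ R` of the FIXED datum `d` by PATCHING: `H c R := G c` off `e.far R⋆`, `:= Ĝ R` on `e.far R⋆` (`K₀ ∩ e.far R⋆ = ∅`,
`R⋆ < R⋆⋆ < R`; on the collar both equal `d`). Then `H c R` is jointly smooth (locality), admissible (vacuum is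
local; `mem_admissibleVacuumData_of_agree_off_compact`), Kerr-ended (`HasExactKerrEnd.of_eq_off_compact`),
DR-flat with the masses of `Ĝ R` (`congr_of_eqOn_far`), and `e.wDist (H c R) (G c) = e.wDist (Ĝ R) d → 0`
UNIFORMLY in `c` — `JointConvergence`/`UniformBound` for free — and the far modification is `c`-INDEPENDENT.
Registered stubs (v4.2; all ≤ 4k chars, importable vocabulary):

* `stub_smoothCompactNakedExit`, `stub_smoothCompactCensoredExit` (OPEN physics) — the summit's two settled exits (items
  stmt-17383 `NakedDataTameExit`, stmt-17348 `TameCensoredDataExit`, other routes' cruxes) in the WEAKEST witness form: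
  a SMOOTH one-parameter, COMPACTLY SUPPORTED deformation inside the admissible class (`F 0 = D`, members `= D` off one
  compact set) whose small non-zero members are settled (Christodoulou's lines `α₀ + c f`, `f` of compact support,
  without linearity). Tameness is automatic and immersion/injectivity gauge-borne: LANDED glue
  `compactSettledTameAccess_of_smoothCompactExits` (p167746, over Literature `TameGaugedFamily` of seat 0 and the LANDED
  `stub_compactSettledBreathing` p166170). RECOMMENDED FOR PROMOTION as compact variants of those items;
* `stub_matchedKerrGluingCurve` (OPEN analysis) — VERBATIM the sibling crux E's curve-indexed atom S1♭ (hypothesis 1 of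
  the landed `tameEscapeToKerrEnds_of_matchedKerrGluingCurve_of_nonposMassKerrEnded`; implied by E's registered S1 and by
  its unit-scale S1♭♭, both landed implications) — the ONLY analytic gluing content left in `C₁`, literally shared;
* `stub_radialOfCurve` — curve-indexed ⟹ radius-indexed receding gluing: LANDED p166340 (wave-1 worker);
* `stub_patchAlongCompactFamily` — THE PATCH: LANDED p166625 (lead; `GluedStructure`, admissible Kerr-ended members,
  `c`-independent far field, exact `wDist` identity, `JointConvergence`, `UniformBound`);
* `stub_reEndingAbsorptionC` (OPEN physics, the hardest, held by the lead) — re-ending absorption RESTATED for the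
  compact architecture: two extra hypotheses (compact support of `G`; `c`-independence of the far field of `H`) and
  `HasExactKerrEnd (H c R)` in place of chart-exactness beyond `4R`.

Composition (§7, sorry-free): `CensorshipAlongKerrEnds_of : MGHDExists → AdmissibleMassNonneg →
ZeroMassAdmissibleMinkowskian → stub_smoothCompactNakedExit → stub_smoothCompactCensoredExit → stub_matchedKerrGluingCurve →
stub_reEndingAbsorptionC → CensorshipAlongKerrEnds` — THREE items by name (stmt-9937, stmt-18051, stmt-18053) and FOUR open
stubs; every bookkeeping stub is landed. The v3.5 decomposition stays landed (p160948) and valid.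

Crux (FIXED, concluded BY NAME in `CensorshipAlongKerrEnds_of`): for every `X`, end `e` and tame curve `F` of
admissible data on `e`, immersed-injective or constant, whose members off `0` are KERR-ENDED, there are `e'` and a
tame, injective, immersed curve `F'` of admissible data with `F' 0 = F 0` whose members off `0` are Kerr-ended AND
CENSORED (every MGHD has complete `𝓘⁺`, sojourn form).

Disproof read: `Cruxes/CensorshipAlongKerrEnds/Disproof.lean` (cdisprove cycle 1, 2026-08-17T08:34Z, unchanged at
14:10Z): NO KILL; no `-- Targets`; used: `crux_iff_immInjOnly` / `withoutCensored_holds` (all content is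
censoredness of the output), `withoutKerrEndedHyp_iff` ([H4] is the interface to E; unused by this line). Sojourn
form re-read (Statement + NullInfinity): Kerr-ending the far field does NOT make censoredness automatic (the sojourn
in `J⁺(ι B₀)` before a ray enters `J⁺(ι K')` is `≈ (r_B − 4R)/2`, independent of the start radius), so the physics
stub is genuinely interior physics. Dead lines: none.
-/

noncomputable section

set_option linter.dupNamespace false
set_option linter.unusedSectionVars false

open Set Function Filter
open scoped Manifold ContDiff Topology ENNReal

namespace Summit.FinalStateConjecture.FinalStateConjecture.Cruxes.CensorshipAlongKerrEnds.SketchLine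

open Literature.Geometry.Lorentzian
open Summit.FinalStateConjecture.FinalStateConjecture.Theses.ExactKerrEnds
  (CensorshipAlongKerrEnds MGHDExists AdmissibleMassNonneg ZeroMassAdmissibleMinkowskian)
open Summit.FinalStateConjecture.FinalStateConjecture.Theorems.SwallowTheDatum.ParametricKerrBurial
  (SmoothSectionsOn AgreeAt)
open Summit.FinalStateConjecture.FinalStateConjecture.Theorems.ExactKerrEnds
  (censored_breatheFamily chartKerrEnd IsChartExactKerrBeyond gluedDom GluedStructure JointConvergence UniformBound
    EventuallyOnBands)

/-! ## §1 Short forms -/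
section ShortForms

variable {X : Type} [TopologicalSpace X] [ChartedSpace E3 X] [IsManifold (𝓡 3) ∞ X] [T2Space X]
  [SecondCountableTopology X] [ConnectedSpace X]

/-- `KerrEnded D` — verbatim the crux's let-bound legend (= `InitialDataSet.HasExactKerrEnd`,
`InitialDataSet.hasExactKerrEnd_iff`). [cite: CorvinoSchoen2006, Thm. 5] -/
def KerrEnded (D : InitialDataSet (𝓡 3) X) : Prop :=
  ∀ [Kerr.Facts], ∃ (K : Set X) (U : TopologicalSpace.Opens E3) (M a r₀ : ℝ) (hM : 0 ≤ M) (φ : U → X)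
    (ψ : U → Kerr.region a r₀) (ν : NormalField 𝓘(ℝ, E4) ψ),
    IsCompact K ∧ Kᶜ ⊆ range φ ∧ Topology.IsOpenEmbedding φ ∧
      ContMDiff 𝓘(ℝ, E3) (𝓡 3) ((⊤ : ℕ∞) : WithTop ℕ∞) φ ∧ Injective ψ ∧
      (Kerr.smoothMetric M a r₀).IsSpacelikeImmersion 𝓘(ℝ, E3) ψ ∧
      (Kerr.smoothMetric M a r₀).IsFutureUnitNormal 𝓘(ℝ, E3)
        ((Kerr.timeOrientation M a r₀ hM).ofLE le_top) ψ ν ∧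
      (∀ (y : U) (v w : E3), φ y ∉ K →
        D.h.inner (φ y) (mfderiv 𝓘(ℝ, E3) (𝓡 3) φ y v) (mfderiv 𝓘(ℝ, E3) (𝓡 3) φ y w) =
          Kerr.bilin M a (ψ y : E4) (mfderiv 𝓘(ℝ, E3) 𝓘(ℝ, E4) ψ y v)
            (mfderiv 𝓘(ℝ, E3) 𝓘(ℝ, E4) ψ y w)) ∧
      (∀ [(Kerr.smoothMetric M a r₀).HasLeviCivita] (y : U) (v w : E3), φ y ∉ K →
        D.k (φ y) (mfderiv 𝓘(ℝ, E3) (𝓡 3) φ y v) (mfderiv 𝓘(ℝ, E3) (𝓡 3) φ y w) =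
          (Kerr.smoothMetric M a r₀).secondFundamentalForm 𝓘(ℝ, E3) ψ ν y v w)

/-- The legend IS the Literature notion `HasExactKerrEnd` (definitional). [folklore] -/
theorem kerrEnded_iff_hasExactKerrEnd (D : InitialDataSet (𝓡 3) X) : KerrEnded D ↔ D.HasExactKerrEnd :=
  Iff.rfl

/-- `Censored D` — every maximal vacuum Cauchy development has complete `𝓘⁺` (sojourn form).
[cite: Christodoulou1999, pp. A26–A27] -/
def Censored (D : InitialDataSet (𝓡 3) X) : Prop :=
  ∀ 𝒟 : VacuumCauchyDevelopment D, 𝒟.IsMaximal →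
    Summit.FinalStateConjecture.HasCompleteNullInfinity 𝒟.toCauchyDevelopment

/-- `Settled D` — VERBATIM the property whose tame genericity the Statement asserts. [cite: DafermosLuk2017, Conjecture 1] -/
def Settled (D : InitialDataSet (𝓡 3) X) : Prop :=
  (∃ 𝒟 : VacuumCauchyDevelopment D, 𝒟.IsMaximal) ∧
    ∀ 𝒟 : VacuumCauchyDevelopment D, 𝒟.IsMaximal →
      Summit.FinalStateConjecture.HasCompleteNullInfinity 𝒟.toCauchyDevelopment ∧
        ∃ (O : Set 𝒟.carrier) (d : FinalStateDecomposition 𝒟.toSpacetime O 2),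
          (∀ i, Kerr.IsSubextremal (d.mass i) (d.spin i)) ∧
            O = Summit.FinalStateConjecture.exteriorOf 𝒟.toCauchyDevelopment d.charted ∧
              Summit.FinalStateConjecture.RaysStayInClosure 𝒟.toCauchyDevelopment O ∧
                Summit.FinalStateConjecture.HasExhaustiveCharts d ∧
                  Summit.FinalStateConjecture.IsFutureOriented d

/-- `GoodCurveThrough d` — the conclusion shape of the crux at the base `d`. -/
def GoodCurveThrough (d : InitialDataSet (𝓡 3) X) : Prop :=
  ∃ (e' : AFEnd X) (F' : EuclideanSpace ℝ (Fin 1) → InitialDataSet (𝓡 3) X),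
    InitialDataSet.IsTameDataFamily e' 1 F' ∧ F' 0 = d ∧ Injective F' ∧
      InitialDataSet.IsImmersedAtZero 1 F' ∧ (∀ c, F' c ∈ admissibleVacuumData X) ∧
        ∀ c ≠ 0, KerrEnded (F' c) ∧ Censored (F' c)

/-- `AgreeOffCompact G d` — the family `G` is a COMPACTLY SUPPORTED modification of `d`: all members agree with
`d` (metric and `k` pointwise) off one compact set. [cite: Christodoulou1999, p. A24] -/
def AgreeOffCompact (G : EuclideanSpace ℝ (Fin 1) → InitialDataSet (𝓡 3) X) (d : InitialDataSet (𝓡 3) X) : Prop :=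
  ∃ K : Set X, IsCompact K ∧ ∀ (c : EuclideanSpace ℝ (Fin 1)) (x : X), x ∉ K → AgreeAt (G c) d x

/-- **Kerr-ended censored self-witness.** Through an admissible datum which is Kerr-ended and censored passes a good
curve: its breathing curve, along which Kerr-endedness (`HasExactKerrEnd.breatheFamily`) and censoredness
(`censored_breatheFamily`) are transported. [cite: Christodoulou1999, p. A24] -/
theorem goodCurveThrough_of_kerrEnded_censored {d : InitialDataSet (𝓡 3) X} (hd : d ∈ admissibleVacuumData X)
    (hKE : KerrEnded d) (hC : Censored d) : GoodCurveThrough d := by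
  obtain ⟨-, e₀, M, hsole, hdecay⟩ := id hd
  set z₀ : E3 := (e₀.R + 3) • EuclideanSpace.single (0 : Fin 3) (1 : ℝ) with hz₀
  have hz₀n : ‖z₀‖ = e₀.R + 3 := by
    rw [hz₀, norm_smul, PiLp.norm_single, norm_one, mul_one,
      Real.norm_of_nonneg (by linarith [e₀.R_pos])]
  have B : e₀.BreathingData z₀ 1 := ⟨one_pos, by rw [hz₀n]; linarith⟩
  have hR₁ : e₀.R < e₀.R + 1 := by linarith
  have hKE' : d.HasExactKerrEnd := (kerrEnded_iff_hasExactKerrEnd d).1 hKE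
  exact ⟨e₀.restrict hR₁.le, fun c ↦ AFEnd.breatheFamily B d (c 0),
    AFEnd.isTameDataFamily_restrict_breatheCurve B d hsole hdecay hR₁,
    AFEnd.breatheCurve_zero B d, AFEnd.injective_breatheCurve B d,
    AFEnd.isImmersedAtZero_breatheCurve B d,
    fun c ↦ AFEnd.breatheCurve_mem_admissibleVacuumData B d hd c,
    fun c _ ↦ ⟨(kerrEnded_iff_hasExactKerrEnd _).2 (hKE'.breatheFamily B (c 0)),
      censored_breatheFamily B d (c 0) hC⟩⟩

end ShortForms

/-- Local alias of the crux, used as the conclusion of the INTERMEDIATE compositions so that exactly one theorem of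
the file (`CensorshipAlongKerrEnds_of`, §7) concludes the route decl by name. -/
abbrev C₁ : Prop := CensorshipAlongKerrEnds

/-! ## §2 The v4 short forms: compact access, fixed-datum gluing, patch, absorption -/

/-- **COMPACT SETTLED TAME ACCESS.** Through every admissible `d` passes a tame immersed curve `G` of admissible
data, `G 0 = d`, whose members off `0` (on a window) are SETTLED and which is a compactly supported modification
of `d`. [cite: Christodoulou1999, p. A24] [cite: DafermosLuk2017, Conjecture 1] -/
def CompactSettledTameAccess : Prop :=
  ∀ (X : Type) [TopologicalSpace X] [ChartedSpace E3 X] [IsManifold (𝓡 3) ∞ X] [T2Space X]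
    [SecondCountableTopology X] [ConnectedSpace X],
    ∀ d ∈ admissibleVacuumData X,
      ∃ (e : AFEnd X) (G : EuclideanSpace ℝ (Fin 1) → InitialDataSet (𝓡 3) X),
        InitialDataSet.IsTameDataFamily e 1 G ∧ InitialDataSet.IsImmersedAtZero 1 G ∧ G 0 = d ∧
          (∀ c, G c ∈ admissibleVacuumData X) ∧ AgreeOffCompact G d ∧
            ∃ ε > (0 : ℝ), ∀ c, c ≠ 0 → ‖c‖ < ε → Settled (G c)

/-- **SMOOTH COMPACT NAKED-DATA EXIT** — item stmt-17383 `NakedDataTameExit` (route TangentProfileCensorship) in the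
WEAKEST witness form: through an admissible datum with an MGHD of incomplete `𝓘⁺` passes a SMOOTH one-parameter,
COMPACTLY SUPPORTED deformation inside the admissible class (`F 0 = D`, all members equal to `D` off one compact set)
whose small non-zero members are settled. Tameness is then automatic (`isTameDataFamily_restrict_of_agree_off_compact_one`)
and immersion/injectivity are gauge-borne (`TameGaugedFamily`), see the landed
`compactSettledTameAccess_of_smoothCompactExits`. Physics (positive tame codimension of naked data by compactly supported
deformations — Christodoulou's lines `α₀ + c f`, `f` of compact support); crux-sized; recommended for PROMOTION.
[cite: Christodoulou1999, p. A24] [cite: Christodoulou1999instability, Thm. 4.1] -/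
def SmoothCompactNakedExit : Prop :=
  ∀ (X : Type) [TopologicalSpace X] [ChartedSpace E3 X] [IsManifold (𝓡 3) ∞ X] [T2Space X]
    [SecondCountableTopology X] [ConnectedSpace X],
    ∀ D ∈ admissibleVacuumData X,
      (∃ 𝒟 : VacuumCauchyDevelopment D, 𝒟.IsMaximal ∧
        ¬ Summit.FinalStateConjecture.HasCompleteNullInfinity 𝒟.toCauchyDevelopment) →
      ∃ F : EuclideanSpace ℝ (Fin 1) → InitialDataSet (𝓡 3) X,
        InitialDataSet.IsSmoothDataFamily 1 F ∧ F 0 = D ∧ (∀ c, F c ∈ admissibleVacuumData X) ∧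
          (∃ K : Set X, IsCompact K ∧ ∀ (c : EuclideanSpace ℝ (Fin 1)) (x : X), x ∉ K →
            (F c).h.inner x = D.h.inner x ∧ (F c).k x = D.k x) ∧
          ∃ ε : ℝ, 0 < ε ∧ ∀ c, c ≠ 0 → ‖c‖ < ε → Settled (F c)

/-- **SMOOTH COMPACT CENSORED-DATA EXIT** — item stmt-17348 `TameCensoredDataExit` (route CurvatureOrSymmetry) in the
weakest witness form: through an admissible datum with an MGHD, all of whose MGHDs have complete `𝓘⁺` but one of which
carries no honest sub-extremal final-state decomposition, passes a smooth one-parameter compactly supported deformation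
inside the admissible class whose small non-zero members are settled. Physics; crux-sized; recommended for PROMOTION.
[cite: DafermosLuk2017, Conjecture 1] [cite: Christodoulou1999, p. A24] -/
def SmoothCompactCensoredExit : Prop :=
  ∀ (X : Type) [TopologicalSpace X] [ChartedSpace E3 X] [IsManifold (𝓡 3) ∞ X] [T2Space X]
    [SecondCountableTopology X] [ConnectedSpace X],
    ∀ D ∈ admissibleVacuumData X,
      (∃ 𝒟 : VacuumCauchyDevelopment D, 𝒟.IsMaximal) →
      (∀ 𝒟 : VacuumCauchyDevelopment D, 𝒟.IsMaximal →
        Summit.FinalStateConjecture.HasCompleteNullInfinity 𝒟.toCauchyDevelopment) →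
      (∃ 𝒟 : VacuumCauchyDevelopment D, 𝒟.IsMaximal ∧
        ¬ ∃ (O : Set 𝒟.carrier) (d : FinalStateDecomposition 𝒟.toSpacetime O 2),
          (∀ i, Kerr.IsSubextremal (d.mass i) (d.spin i)) ∧
            O = Summit.FinalStateConjecture.exteriorOf 𝒟.toCauchyDevelopment d.charted ∧
              Summit.FinalStateConjecture.RaysStayInClosure 𝒟.toCauchyDevelopment O ∧
                Summit.FinalStateConjecture.HasExhaustiveCharts d ∧
                  Summit.FinalStateConjecture.IsFutureOriented d) →
      ∃ F : EuclideanSpace ℝ (Fin 1) → InitialDataSet (𝓡 3) X,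
        InitialDataSet.IsSmoothDataFamily 1 F ∧ F 0 = D ∧ (∀ c, F c ∈ admissibleVacuumData X) ∧
          (∃ K : Set X, IsCompact K ∧ ∀ (c : EuclideanSpace ℝ (Fin 1)) (x : X), x ∉ K →
            (F c).h.inner x = D.h.inner x ∧ (F c).k x = D.k x) ∧
          ∃ ε : ℝ, 0 < ε ∧ ∀ c, c ≠ 0 → ‖c‖ < ε → Settled (F c)

/-- **MATCHED KERR GLUING CURVE — the sibling crux E's FIXED-DATUM analytic atom S1♭, VERBATIM** (hypothesis 1 of
the landed `Theorems.ExactKerrEnds.tameEscapeToKerrEnds_of_matchedKerrGluingCurve_of_nonposMassKerrEnded`): through an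
admissible `d` with sole DR end `e` of mass `M > 0` passes a curve `s ↦ G s` (`s > s⋆`) of admissible Kerr-ended data,
jointly smooth in `(s, x)`, equal to `d` off `e.far (ρ s)` with `ρ s → ∞`, DR-flat on `e` with continuous masses
`m s → M`, and `e.wDist (G s) d → 0`. Engine: Corvino–Schoen 2006 Thm 4 / Chruściel–Delay 2003 Thm 8.1 /
Mao–Oh–Tao 2023 Thm 1.3 (matched exterior Kerr gluing) with smooth dependence on the gluing radius; implied by
E's registered radius-indexed S1 (`matchedKerrGluingCurve_of_matchedKerrGluingFamily`) and by its unit-scale S1♭♭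
(`matchedKerrGluingCurve_of_unitCurve`). [cite: CorvinoSchoen2006, Thm. 4] [cite: ChruscielDelay2003, Thm. 8.1]
[cite: MaoOhTao2023, Thm. 1.3] -/
def MatchedKerrGluingCurve : Prop :=
  ∀ (X : Type) [TopologicalSpace X] [ChartedSpace E3 X] [IsManifold (𝓡 3) ∞ X] [T2Space X]
    [SecondCountableTopology X] [ConnectedSpace X], ∀ [Kerr.Facts],
    ∀ d ∈ admissibleVacuumData X, ∀ (e : AFEnd X) (M : ℝ), e.IsSoleEnd → 0 < M →
      e.IsStronglyAsymptoticallyFlatDR d M →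
      ∃ (sstar : ℝ) (ρ m : ℝ → ℝ) (G : ℝ → InitialDataSet (𝓡 3) X),
        Tendsto ρ atTop atTop ∧ ContinuousOn m (Ioi sstar) ∧ Tendsto m atTop (𝓝 M) ∧
        SmoothSectionsOn 𝓘(ℝ, ℝ) G {p : ℝ × X | sstar < p.1} ∧
        (∀ s : ℝ, sstar < s →
          G s ∈ admissibleVacuumData X ∧ (∀ x ∉ e.far (ρ s), AgreeAt (G s) d x) ∧
            e.IsStronglyAsymptoticallyFlatDR (G s) (m s) ∧ (G s).HasExactKerrEnd) ∧
        Tendsto (fun s ↦ e.wDist (G s) d) atTop (𝓝 0)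

/-- **RADIAL KERR GLUING — the radius-indexed receding form** (E's registered S1 `MatchedKerrGluingFamily` with the
chart-exact clause weakened to `HasExactKerrEnd`): a family `G R` (`R > R⋆ > e.R`) of admissible Kerr-ended data,
jointly smooth in `(R, x)`, equal to `d` off `e.far R`, DR-flat with continuous masses `m R → M`, and
`e.wDist (G R) d → 0`. [cite: CorvinoSchoen2006, Thm. 4] -/
def RadialKerrGluing : Prop :=
  ∀ (X : Type) [TopologicalSpace X] [ChartedSpace E3 X] [IsManifold (𝓡 3) ∞ X] [T2Space X]
    [SecondCountableTopology X] [ConnectedSpace X], ∀ [Kerr.Facts],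
    ∀ d ∈ admissibleVacuumData X, ∀ (e : AFEnd X) (M : ℝ), e.IsSoleEnd → 0 < M →
      e.IsStronglyAsymptoticallyFlatDR d M →
      ∃ (Rstar : ℝ) (m : ℝ → ℝ) (G : ℝ → InitialDataSet (𝓡 3) X),
        e.R < Rstar ∧ ContinuousOn m (Ioi Rstar) ∧ Tendsto m atTop (𝓝 M) ∧
        SmoothSectionsOn 𝓘(ℝ, ℝ) G {p : ℝ × X | Rstar < p.1} ∧
        (∀ R : ℝ, Rstar < R →
          G R ∈ admissibleVacuumData X ∧ (∀ x ∉ e.far R, AgreeAt (G R) d x) ∧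
            e.IsStronglyAsymptoticallyFlatDR (G R) (m R) ∧ (G R).HasExactKerrEnd) ∧
        Tendsto (fun R ↦ e.wDist (G R) d) atTop (𝓝 0)

/-- **GLUING ALONG A COMPACTLY SUPPORTED TAME FAMILY** (the v4 core interface): for a tame family `G` of admissible
data on `e` with continuous DR masses `Mf`, `Mf 0 > 0`, which is a compactly supported modification of `G 0`, there
are `ε > 0`, `R⋆ > e.R`, masses `m c R` and a glued family `H c R`: `GluedStructure` (masses continuous, sections
jointly smooth in `((c, R), x)`, `H c R = G c` off `e.far R`, DR-flat with mass `m c R`), members admissible and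
Kerr-ended, the far field of `H c R` on `e.far R⋆` INDEPENDENT of `c`, `e.wDist (H c R) (G c) → 0` pointwise and
jointly with `m c R − Mf c → 0`, and uniformly bounded. [cite: CorvinoSchoen2006, Thm. 4] -/
def GluingAlongCompactFamily : Prop :=
  ∀ (X : Type) [TopologicalSpace X] [ChartedSpace E3 X] [IsManifold (𝓡 3) ∞ X] [T2Space X]
    [SecondCountableTopology X] [ConnectedSpace X], ∀ [Kerr.Facts],
    ∀ (e : AFEnd X) (G : EuclideanSpace ℝ (Fin 1) → InitialDataSet (𝓡 3) X) (Mf : EuclideanSpace ℝ (Fin 1) → ℝ),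
      InitialDataSet.IsTameDataFamily e 1 G → (∀ c, G c ∈ admissibleVacuumData X) →
      Continuous Mf → (∀ c, e.IsStronglyAsymptoticallyFlatDR (G c) (Mf c)) → AgreeOffCompact G (G 0) → 0 < Mf 0 →
      ∃ (ε Rstar : ℝ) (m : EuclideanSpace ℝ (Fin 1) → ℝ → ℝ)
        (H : EuclideanSpace ℝ (Fin 1) → ℝ → InitialDataSet (𝓡 3) X),
        0 < ε ∧ e.R < Rstar ∧ GluedStructure e G ε Rstar m H ∧
        (∀ (c : EuclideanSpace ℝ (Fin 1)) (R : ℝ), ‖c‖ < ε → Rstar < R →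
          H c R ∈ admissibleVacuumData X ∧ (H c R).HasExactKerrEnd) ∧
        (∀ (c c' : EuclideanSpace ℝ (Fin 1)) (R : ℝ), ∀ x ∈ e.far Rstar, AgreeAt (H c R) (H c' R) x) ∧
        (∀ c : EuclideanSpace ℝ (Fin 1), ‖c‖ < ε → Tendsto (fun R ↦ e.wDist (H c R) (G c)) atTop (𝓝 0)) ∧
        JointConvergence e G Mf ε Rstar m H ∧ UniformBound e G ε Rstar H

/-- **THE PATCH (provable bookkeeping, held by the lead).** As `GluingAlongCompactFamily`, GIVEN a radius-indexed
receding Kerr gluing of the base datum `G 0` on `e` with mass limit `Mf 0` (the shape of `RadialKerrGluing`'s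
conclusion): patch `G c` (off `e.far R⋆`) with the glued datum `Ĝ R` (on `e.far R⋆`), `K₀ ∩ e.far R⋆ = ∅`.
[cite: Corvino2000, §4] [cite: CorvinoSchoen2006, Thm. 4] -/
def PatchAlongCompactFamily : Prop :=
  ∀ (X : Type) [TopologicalSpace X] [ChartedSpace E3 X] [IsManifold (𝓡 3) ∞ X] [T2Space X]
    [SecondCountableTopology X] [ConnectedSpace X],
    ∀ (e : AFEnd X) (G : EuclideanSpace ℝ (Fin 1) → InitialDataSet (𝓡 3) X) (Mf : EuclideanSpace ℝ (Fin 1) → ℝ),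
      InitialDataSet.IsTameDataFamily e 1 G → (∀ c, G c ∈ admissibleVacuumData X) →
      Continuous Mf → (∀ c, e.IsStronglyAsymptoticallyFlatDR (G c) (Mf c)) → AgreeOffCompact G (G 0) →
      (∃ (Rstar : ℝ) (m : ℝ → ℝ) (Gh : ℝ → InitialDataSet (𝓡 3) X),
        e.R < Rstar ∧ ContinuousOn m (Ioi Rstar) ∧ Tendsto m atTop (𝓝 (Mf 0)) ∧
        SmoothSectionsOn 𝓘(ℝ, ℝ) Gh {p : ℝ × X | Rstar < p.1} ∧
        (∀ R : ℝ, Rstar < R →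
          Gh R ∈ admissibleVacuumData X ∧ (∀ x ∉ e.far R, AgreeAt (Gh R) (G 0) x) ∧
            e.IsStronglyAsymptoticallyFlatDR (Gh R) (m R) ∧ (Gh R).HasExactKerrEnd) ∧
        Tendsto (fun R ↦ e.wDist (Gh R) (G 0)) atTop (𝓝 0)) →
      ∃ (ε Rstar : ℝ) (m : EuclideanSpace ℝ (Fin 1) → ℝ → ℝ)
        (H : EuclideanSpace ℝ (Fin 1) → ℝ → InitialDataSet (𝓡 3) X),
        0 < ε ∧ e.R < Rstar ∧ GluedStructure e G ε Rstar m H ∧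
        (∀ (c : EuclideanSpace ℝ (Fin 1)) (R : ℝ), ‖c‖ < ε → Rstar < R →
          H c R ∈ admissibleVacuumData X ∧ (H c R).HasExactKerrEnd) ∧
        (∀ (c c' : EuclideanSpace ℝ (Fin 1)) (R : ℝ), ∀ x ∈ e.far Rstar, AgreeAt (H c R) (H c' R) x) ∧
        (∀ c : EuclideanSpace ℝ (Fin 1), ‖c‖ < ε → Tendsto (fun R ↦ e.wDist (H c R) (G c)) atTop (𝓝 0)) ∧
        JointConvergence e G Mf ε Rstar m H ∧ UniformBound e G ε Rstar H

/-- **PHYSICS — re-ending absorption in the compact architecture (OPEN; the hardest stub, held by the lead).**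
Along a glued family `H` over a tame admissible family `G` which is a compactly supported modification of `G 0`
and whose members on the punctured window `0 < ‖c‖ < ε` are SETTLED — `H c R = G c` off `e.far R`, the far field
of `H c R` on `e.far R⋆` the SAME for all `c` (one receding re-ending of the common far field of the `G c`),
members admissible and Kerr-ended, `e.wDist (H c R) (G c)` uniformly bounded and `→ 0` jointly — for every compact
band `C ∌ 0` of parameters there is `R₂` beyond which every `H c R`, `c ∈ C`, is CENSORED. Content: asymptotic
stability of settled developments under a receding, weighted-small re-ending of the far field (for each `c`), locally
uniformly in `c` — where now `c ↦ G c` varies smoothly INSIDE A FIXED COMPACT SET only, so local uniformity is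
stability of censoredness of settled data under small compactly supported perturbations (Cauchy stability + Kerr
stability from a late leaf). Open for `N ≥ 2` final holes and for `|a| → M` (SlowlyRotatingKerrFrontier); not
derivable from the tree's named stability facts (`Settled` is qualitative). [cite: KlainermanSzeftel2023, Thm. 1.1]
[cite: KlainermanNicolo2003, Thm. 3.7.1] [cite: DafermosLuk2017, Conjecture 1] -/
def ReEndingAbsorptionC : Prop :=
  ∀ (X : Type) [TopologicalSpace X] [ChartedSpace E3 X] [IsManifold (𝓡 3) ∞ X] [T2Space X]
    [SecondCountableTopology X] [ConnectedSpace X], ∀ [Kerr.Facts],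
    ∀ (e : AFEnd X) (G : EuclideanSpace ℝ (Fin 1) → InitialDataSet (𝓡 3) X) (Mf : EuclideanSpace ℝ (Fin 1) → ℝ)
      (ε Rstar : ℝ) (m : EuclideanSpace ℝ (Fin 1) → ℝ → ℝ)
      (H : EuclideanSpace ℝ (Fin 1) → ℝ → InitialDataSet (𝓡 3) X),
      InitialDataSet.IsTameDataFamily e 1 G → (∀ c, G c ∈ admissibleVacuumData X) →
      Continuous Mf → (∀ c, e.IsStronglyAsymptoticallyFlatDR (G c) (Mf c)) → AgreeOffCompact G (G 0) →
      0 < ε → e.R < Rstar →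
      (∀ c : EuclideanSpace ℝ (Fin 1), c ≠ 0 → ‖c‖ < ε → Settled (G c)) →
      GluedStructure e G ε Rstar m H →
      (∀ (c : EuclideanSpace ℝ (Fin 1)) (R : ℝ), ‖c‖ < ε → Rstar < R →
        H c R ∈ admissibleVacuumData X ∧ (H c R).HasExactKerrEnd) →
      (∀ (c c' : EuclideanSpace ℝ (Fin 1)) (R : ℝ), ∀ x ∈ e.far Rstar, AgreeAt (H c R) (H c' R) x) →
      (∀ c : EuclideanSpace ℝ (Fin 1), ‖c‖ < ε → Tendsto (fun R ↦ e.wDist (H c R) (G c)) atTop (𝓝 0)) →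
      JointConvergence e G Mf ε Rstar m H → UniformBound e G ε Rstar H →
      EventuallyOnBands Censored ε Rstar H

/-- **BOOKKEEPING — receding selection** (LANDED p153977, lead c1; statement unchanged). [cite: Christodoulou1999, p. A24] -/
def RecedingSelection : Prop :=
  ∀ (X : Type) [TopologicalSpace X] [ChartedSpace E3 X] [IsManifold (𝓡 3) ∞ X] [T2Space X]
    [SecondCountableTopology X] [ConnectedSpace X],
    ∀ (P : InitialDataSet (𝓡 3) X → Prop) (e : AFEnd X) (G : EuclideanSpace ℝ (Fin 1) → InitialDataSet (𝓡 3) X)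
      (Mf : EuclideanSpace ℝ (Fin 1) → ℝ) (ε Rstar : ℝ) (m : EuclideanSpace ℝ (Fin 1) → ℝ → ℝ)
      (H : EuclideanSpace ℝ (Fin 1) → ℝ → InitialDataSet (𝓡 3) X),
      InitialDataSet.IsTameDataFamily e 1 G → InitialDataSet.IsImmersedAtZero 1 G →
      Continuous Mf → (∀ c, e.IsStronglyAsymptoticallyFlatDR (G c) (Mf c)) →
      0 < ε → e.R < Rstar → GluedStructure e G ε Rstar m H → JointConvergence e G Mf ε Rstar m H →
      EventuallyOnBands P ε Rstar H →
      ∃ F' : EuclideanSpace ℝ (Fin 1) → InitialDataSet (𝓡 3) X,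
        InitialDataSet.IsTameDataFamily e 1 F' ∧ InitialDataSet.IsImmersedAtZero 1 F' ∧ F' 0 = G 0 ∧
          ∃ ε' > (0 : ℝ), ∀ c, c ≠ 0 → ‖c‖ < ε' → P (F' c)

/-- **Base mass `≤ 0` forces an exact Kerr (indeed Minkowskian) end** (the sibling crux E's S2). [cite: BeigChrusciel1996, Thm. 4.1] -/
def NonposMassKerrEnded : Prop :=
  ∀ (X : Type) [TopologicalSpace X] [ChartedSpace E3 X] [IsManifold (𝓡 3) ∞ X] [T2Space X]
    [SecondCountableTopology X] [ConnectedSpace X],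
    ∀ d ∈ admissibleVacuumData X, ∀ (e : AFEnd X) (M : ℝ), e.IsSoleEnd → M ≤ 0 →
      e.IsStronglyAsymptoticallyFlatDR d M → d.HasExactKerrEnd

/-- **Base mass `≤ 0` forces censoredness** (Minkowskian Cauchy development). [cite: BeigChrusciel1996, Thm. 4.1] -/
def NonposMassCensored : Prop :=
  ∀ (X : Type) [TopologicalSpace X] [ChartedSpace E3 X] [IsManifold (𝓡 3) ∞ X] [T2Space X]
    [SecondCountableTopology X] [ConnectedSpace X],
    ∀ d ∈ admissibleVacuumData X, ∀ (e : AFEnd X) (M : ℝ), e.IsSoleEnd → M ≤ 0 →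
      e.IsStronglyAsymptoticallyFlatDR d M → Censored d

section MassBranch

variable {X : Type} [TopologicalSpace X] [ChartedSpace E3 X] [IsManifold (𝓡 3) ∞ X] [T2Space X]
  [SecondCountableTopology X] [ConnectedSpace X]

/-- **A non-positive DR mass on a sole end of an admissible datum is zero and the datum is Minkowskian** (adapter to
the route items `AdmissibleMassNonneg` stmt-18051 / `ZeroMassAdmissibleMinkowskian` stmt-18053).
[cite: BeigChrusciel1996, Thm. 4.1] [cite: EichmairHuangLeeSchoen2016, Thm. 1] -/
theorem exists_cauchyDevelopment_eq_minkowski_of_items (hA : AdmissibleMassNonneg)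
    (hZ : ZeroMassAdmissibleMinkowskian) {d : InitialDataSet (𝓡 3) X} (hd : d ∈ admissibleVacuumData X)
    {e : AFEnd X} {M : ℝ} (hsole : e.IsSoleEnd) (hM : M ≤ 0) (hDR : e.IsStronglyAsymptoticallyFlatDR d M) :
    ∃ 𝒟 : CauchyDevelopment d, 𝒟.toSpacetime = Minkowski.spacetime := by
  have hM0 : M = 0 := le_antisymm hM (hA X d hd e M hsole hDR)
  subst hM0
  exact hZ X d hd e hsole hDR

end MassBranch

/-- **`NonposMassKerrEnded` is DISCHARGED from the two route items.** [folklore] -/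
theorem nonposMassKerrEnded_of_items (hA : AdmissibleMassNonneg) (hZ : ZeroMassAdmissibleMinkowskian) :
    NonposMassKerrEnded := by
  intro X _ _ _ _ _ _ d hd e M hsole hM hDR
  obtain ⟨𝒟, h𝒟⟩ := exists_cauchyDevelopment_eq_minkowski_of_items hA hZ hd hsole hM hDR
  exact Summit.FinalStateConjecture.FinalStateConjecture.Theorems.ExactKerrEnds.hasExactKerrEnd_of_cauchyDevelopment_eq_minkowski
    X d e hsole 𝒟 h𝒟

/-- **`NonposMassCensored` is DISCHARGED from the two route items** (`censored_of_cauchyDevelopment_eq_minkowski`,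
p153768). [folklore] -/
theorem nonposMassCensored_of_items (hA : AdmissibleMassNonneg) (hZ : ZeroMassAdmissibleMinkowskian) :
    NonposMassCensored := by
  intro X _ _ _ _ _ _ d hd e M hsole hM hDR
  obtain ⟨𝒟, h𝒟⟩ := exists_cauchyDevelopment_eq_minkowski_of_items hA hZ hd hsole hM hDR
  exact Summit.FinalStateConjecture.FinalStateConjecture.Theorems.ExactKerrEnds.censored_of_cauchyDevelopment_eq_minkowski
    X d 𝒟 h𝒟

/-! ## §3 The other adapters -/

/-- WINDOW UPGRADE (LANDED p148379). -/
def WindowUpgrade : Prop :=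
  ∀ (X : Type) [TopologicalSpace X] [ChartedSpace E3 X] [IsManifold (𝓡 3) ∞ X] [T2Space X]
    [SecondCountableTopology X] [ConnectedSpace X],
    ∀ (P : InitialDataSet (𝓡 3) X → Prop) (e : AFEnd X) (F : EuclideanSpace ℝ (Fin 1) → InitialDataSet (𝓡 3) X),
      InitialDataSet.IsTameDataFamily e 1 F → InitialDataSet.IsImmersedAtZero 1 F →
        (∃ ε > (0 : ℝ), ∀ c, c ≠ 0 → ‖c‖ < ε → P (F c)) →
          ∃ F' : EuclideanSpace ℝ (Fin 1) → InitialDataSet (𝓡 3) X,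
            InitialDataSet.IsTameDataFamily e 1 F' ∧ F' 0 = F 0 ∧ Injective F' ∧
              InitialDataSet.IsImmersedAtZero 1 F' ∧ ∀ c ≠ 0, P (F' c)

/-- The canonical instance of the Kerr–Schild facts (all three fields are theorems of the Literature). [folklore] -/
theorem kerrFacts : Kerr.Facts :=
  ⟨Kerr.isConnected_region_holds, Kerr.contMDiff_bilin_holds, Kerr.contMDiff_timeVector_holds⟩

/-! ## §4 The transplant composition (v4, compact architecture) -/

section Transplant

variable {X : Type} [TopologicalSpace X] [ChartedSpace E3 X] [IsManifold (𝓡 3) ∞ X] [T2Space X]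
  [SecondCountableTopology X] [ConnectedSpace X]

/-- Restricting the structural clauses of a glued family to a smaller parameter ball. [folklore] -/
theorem gluedStructure_mono {e : AFEnd X} {G : EuclideanSpace ℝ (Fin 1) → InitialDataSet (𝓡 3) X} {ε ε' Rstar : ℝ}
    {m : EuclideanSpace ℝ (Fin 1) → ℝ → ℝ} {H : EuclideanSpace ℝ (Fin 1) → ℝ → InitialDataSet (𝓡 3) X}
    (h : GluedStructure e G ε Rstar m H) (hε' : ε' ≤ ε) : GluedStructure e G ε' Rstar m H := by
  obtain ⟨hm, hH, hmem⟩ := h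
  refine ⟨hm.mono fun q hq ↦ ⟨lt_of_lt_of_le hq.1 hε', hq.2⟩,
    ⟨hH.1.mono fun p hp ↦ ⟨lt_of_lt_of_le hp.1 hε', hp.2⟩, hH.2.mono fun p hp ↦ ⟨lt_of_lt_of_le hp.1 hε', hp.2⟩⟩,
    fun c R hc hR ↦ hmem c R (lt_of_lt_of_le hc hε') hR⟩

/-- Re-basing joint convergence on another (positive) parameter radius: the clause only shrinks `ε₁`. [folklore] -/
theorem jointConvergence_mono {e : AFEnd X} {G : EuclideanSpace ℝ (Fin 1) → InitialDataSet (𝓡 3) X}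
    {Mf : EuclideanSpace ℝ (Fin 1) → ℝ} {ε ε' Rstar : ℝ}
    {m : EuclideanSpace ℝ (Fin 1) → ℝ → ℝ} {H : EuclideanSpace ℝ (Fin 1) → ℝ → InitialDataSet (𝓡 3) X}
    (h : JointConvergence e G Mf ε Rstar m H) (hε'pos : 0 < ε') :
    JointConvergence e G Mf ε' Rstar m H := by
  intro η hη
  obtain ⟨ε₁, R₁, hε₁, -, hR₁, hcl⟩ := h η hη
  exact ⟨min ε₁ ε', R₁, lt_min hε₁ hε'pos, min_le_right _ _, hR₁,
    fun c R hc hR ↦ hcl c R (lt_of_lt_of_le hc (min_le_left _ _)) hR⟩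

/-- **C₁ by transplanting the end, v4 (compact architecture), PROVED from the short forms.** -/
theorem censorshipAlongKerrEnds_of_compact_transplant (hW : WindowUpgrade) (hA : CompactSettledTameAccess)
    (hcore : GluingAlongCompactFamily) (hsel : RecedingSelection) (habs : ReEndingAbsorptionC)
    (hK : NonposMassKerrEnded) (hC : NonposMassCensored) : C₁ := by
  intro X _ _ _ _ _ _ KerrEnded' Censored' e F hF hshape hadm hKE
  have hd : F 0 ∈ admissibleVacuumData X := hadm 0
  obtain ⟨e₁, G, hGt, hGi, hG0, hGadm, hGcpt, ε, hε, hGset⟩ := hA X (F 0) hd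
  obtain ⟨Mf, hMf, hDR⟩ := hGt.2.2.1
  have hsole : e₁.IsSoleEnd := hGt.2.1
  have hGcpt' : AgreeOffCompact G (G 0) := by rw [hG0]; exact hGcpt
  by_cases hpos : 0 < Mf 0
  · -- gluing branch
    haveI : Kerr.Facts := kerrFacts
    obtain ⟨ε₀, Rstar, m, H, hε₀, hRstar, hstr, hmem, hfarc, hpt, hjoint, hbd⟩ :=
      hcore X e₁ G Mf hGt hGadm hMf hDR hGcpt' hpos
    set ε₂ : ℝ := min ε ε₀ with hε₂def
    have hε₂ : 0 < ε₂ := lt_min hε hε₀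
    have hε₂ε : ε₂ ≤ ε := min_le_left _ _
    have hε₂ε₀ : ε₂ ≤ ε₀ := min_le_right _ _
    have hstr₂ : GluedStructure e₁ G ε₂ Rstar m H := gluedStructure_mono hstr hε₂ε₀
    have hjoint₂ : JointConvergence e₁ G Mf ε₂ Rstar m H := jointConvergence_mono hjoint hε₂
    have hmem₂ : ∀ (c : EuclideanSpace ℝ (Fin 1)) (R : ℝ), ‖c‖ < ε₂ → Rstar < R →
        H c R ∈ admissibleVacuumData X ∧ (H c R).HasExactKerrEnd :=
      fun c R hc hR ↦ hmem c R (lt_of_lt_of_le hc hε₂ε₀) hR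
    have hpt₂ : ∀ c : EuclideanSpace ℝ (Fin 1), ‖c‖ < ε₂ →
        Tendsto (fun R ↦ e₁.wDist (H c R) (G c)) atTop (𝓝 0) :=
      fun c hc ↦ hpt c (lt_of_lt_of_le hc hε₂ε₀)
    have hset₂ : ∀ c : EuclideanSpace ℝ (Fin 1), c ≠ 0 → ‖c‖ < ε₂ → Settled (G c) :=
      fun c hc hcε ↦ hGset c hc (lt_of_lt_of_le hcε hε₂ε)
    have hbd₂ : UniformBound e₁ G ε₂ Rstar H := by
      obtain ⟨B, hB⟩ := hbd
      exact ⟨B, fun c R hc hR ↦ hB c R (lt_of_lt_of_le hc hε₂ε₀) hR⟩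
    -- physics: censoredness of the re-ended members on compact bands
    have hcens : EventuallyOnBands Censored ε₂ Rstar H :=
      habs X e₁ G Mf ε₂ Rstar m H hGt hGadm hMf hDR hGcpt' hε₂ hRstar hset₂ hstr₂ hmem₂ hfarc hpt₂ hjoint₂ hbd₂
    -- the property to be selected: admissible ∧ Kerr-ended ∧ censored
    have hP : EventuallyOnBands (fun D ↦ D ∈ admissibleVacuumData X ∧ KerrEnded D ∧ Censored D) ε₂ Rstar H := by
      intro C hC h0 hCε
      obtain ⟨R₂, hR₂, hR₂P⟩ := hcens C hC h0 hCε
      refine ⟨R₂, hR₂, fun c hc R hR ↦ ?_⟩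
      have hcε : ‖c‖ < ε₂ := by simpa using hCε hc
      have hRstarR : Rstar < R := lt_of_le_of_lt hR₂ hR
      obtain ⟨hadm', hKE'⟩ := hmem₂ c R hcε hRstarR
      -- `@hKE'`: with `[Kerr.Facts]` in scope a bare term of this type would be auto-applied to the instance;
      -- `KerrEnded D` and `D.HasExactKerrEnd` are the same term (`kerrEnded_iff_hasExactKerrEnd` is `Iff.rfl`)
      have hKE'' : KerrEnded (H c R) := @hKE'
      exact ⟨hadm', @hKE'', hR₂P c hc R hR⟩
    -- bookkeeping: select a smooth receding radius
    obtain ⟨F', hF't, hF'i, hF'0, ε', hε', hF'P⟩ :=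
      hsel X (fun D ↦ D ∈ admissibleVacuumData X ∧ KerrEnded D ∧ Censored D) e₁ G Mf ε₂ Rstar m H
        hGt hGi hMf hDR hε₂ hRstar hstr₂ hjoint₂ hP
    -- window upgrade (landed)
    obtain ⟨F'', hF''t, hF''0, hF''inj, hF''i, hF''P⟩ :=
      hW X (fun D ↦ D ∈ admissibleVacuumData X ∧ KerrEnded D ∧ Censored D) e₁ F' hF't hF'i ⟨ε', hε', hF'P⟩
    refine ⟨e₁, F'', hF''t, hF''0.trans (hF'0.trans hG0), hF''inj, hF''i, ?_, ?_⟩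
    · intro c
      by_cases hc : c = 0
      · subst hc
        rw [hF''0, hF'0, hG0]
        exact hd
      · exact (hF''P c hc).1
    · intro c hc
      exact ⟨(hF''P c hc).2.1, (hF''P c hc).2.2⟩
  · -- flat base branch: the base datum is Kerr-ended and censored
    have hle : Mf 0 ≤ 0 := not_lt.mp hpos
    have hKE0 : KerrEnded (F 0) := by
      rw [← hG0]
      exact (kerrEnded_iff_hasExactKerrEnd _).2 (hK X (G 0) (hGadm 0) e₁ (Mf 0) hsole hle (hDR 0))
    have hC0 : Censored (F 0) := by
      rw [← hG0]
      exact hC X (G 0) (hGadm 0) e₁ (Mf 0) hsole hle (hDR 0)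
    obtain ⟨e', F', hF't, hF'0, hF'inj, hF'i, hF'adm, hgood⟩ := goodCurveThrough_of_kerrEnded_censored hd hKE0 hC0
    exact ⟨e', F', hF't, hF'0, hF'inj, hF'i, hF'adm, hgood⟩

end Transplant

/-! ## §5 Compact settled access = the two COMPACT exits + MGHD existence + compact settled breathing -/

section Upgrade

variable {X : Type} [TopologicalSpace X] [ChartedSpace E3 X] [IsManifold (𝓡 3) ∞ X] [T2Space X]
  [SecondCountableTopology X] [ConnectedSpace X]

open Summit.FinalStateConjecture.FinalStateConjecture.Theorems.PhaseMixingCaptureCaptureSufficesC2 (summit_breatheFamily)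

/-- In `ℝ¹`, the quadratic axis point `ρ c = (c 0)² e₀` has norm `≤ ‖c‖` when `‖c‖ ≤ 1` (in-skeleton copy of the landed
`…CensorshipAlongKerrEnds.norm_quadAxis_le`, p167746, kept here while the farm builds that module). [folklore] -/
theorem norm_quadAxis_le' {c : EuclideanSpace ℝ (Fin 1)} (hc : ‖c‖ ≤ 1) :
    ‖(EuclideanSpace.single 0 ((c 0) ^ 2) : EuclideanSpace ℝ (Fin 1))‖ ≤ ‖c‖ := by
  have h0 : ‖c 0‖ ≤ ‖c‖ := PiLp.norm_apply_le c 0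
  rw [PiLp.norm_single, norm_pow, pow_two]
  calc ‖c 0‖ * ‖c 0‖ ≤ ‖c‖ * 1 := mul_le_mul h0 (h0.trans hc) (norm_nonneg _) (norm_nonneg _)
    _ = ‖c‖ := mul_one _

/-- **Compact settled tame access from a SMOOTH compactly supported settled deformation** (in-skeleton copy of the landed
`…CensorshipAlongKerrEnds.exists_compactSettledAccess_of_smooth`, p167746: tameness by
`isTameDataFamily_restrict_of_agree_off_compact_one`, immersion gauge-borne by the gauged family of `TameGaugedFamily`,
compact support kept because the breathing diffeomorphisms are the identity off the compact core, settledness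
breathing-invariant by `summit_breatheFamily`, window by `exists_tameCurve_of_localWindow`). [cite: Christodoulou1999, p. A24] -/
theorem exists_compactSettledAccess_of_smooth' {d : InitialDataSet (𝓡 3) X} (hd : d ∈ admissibleVacuumData X)
    {F : EuclideanSpace ℝ (Fin 1) → InitialDataSet (𝓡 3) X} (hF : InitialDataSet.IsSmoothDataFamily 1 F)
    (hF0 : F 0 = d) (hFadm : ∀ c, F c ∈ admissibleVacuumData X) {K : Set X} (hK : IsCompact K)
    (hagree : ∀ (c : EuclideanSpace ℝ (Fin 1)) (x : X), x ∉ K → (F c).h.inner x = d.h.inner x ∧ (F c).k x = d.k x)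
    {ε : ℝ} (hε : 0 < ε) (hgood : ∀ c : EuclideanSpace ℝ (Fin 1), c ≠ 0 → ‖c‖ < ε → Settled (F c)) :
    ∃ (e : AFEnd X) (G : EuclideanSpace ℝ (Fin 1) → InitialDataSet (𝓡 3) X),
      InitialDataSet.IsTameDataFamily e 1 G ∧ InitialDataSet.IsImmersedAtZero 1 G ∧ G 0 = d ∧
        (∀ c, G c ∈ admissibleVacuumData X) ∧ AgreeOffCompact G d ∧
        ∃ ε' > (0 : ℝ), ∀ c : EuclideanSpace ℝ (Fin 1), c ≠ 0 → ‖c‖ < ε' → Settled (G c) := by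
  obtain ⟨-, e₀, M, hsole, hDR⟩ := id hd
  have hR₁ : e₀.R < e₀.R + 1 := by linarith
  have hDR0 : e₀.IsStronglyAsymptoticallyFlatDR (F 0) M := by rw [hF0]; exact hDR
  have hagree0 : ∀ c, ∀ x ∉ K, (F c).h.inner x = (F 0).h.inner x ∧ (F c).k x = (F 0).k x := by
    intro c x hx; rw [hF0]; exact hagree c x hx
  have hFt : InitialDataSet.IsTameDataFamily (e₀.restrict hR₁.le) 1 F :=
    InitialDataSet.isTameDataFamily_restrict_of_agree_off_compact_one hF hsole hDR0 hK hagree0 hR₁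
  set e₁ : AFEnd X := e₀.restrict hR₁.le with he₁
  set z₀ : E3 := (e₁.R + 3) • EuclideanSpace.single (0 : Fin 3) (1 : ℝ) with hz₀
  have hz₀n : ‖z₀‖ = e₁.R + 3 := by
    rw [hz₀, norm_smul, PiLp.norm_single, norm_one, mul_one, Real.norm_of_nonneg (by linarith [e₁.R_pos])]
  have B : e₁.BreathingData z₀ 1 := ⟨one_pos, by rw [hz₀n]; linarith⟩
  have hR₂ : e₁.R < e₁.R + 1 := by linarith
  have h2 := AFEnd.isTameDataFamily_restrict_breatheQuad B F hFt hR₂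
  have h3 := AFEnd.isImmersedAtZero_breatheQuad B F hF
  have hK' : IsCompact (K ∪ AFEnd.breatheCore e₁ z₀ 1) := hK.union (AFEnd.isCompact_breatheCore B)
  have hmem : ∀ c : EuclideanSpace ℝ (Fin 1),
      AFEnd.breatheFamily B (F (EuclideanSpace.single 0 ((c 0) ^ 2))) (c 0) ∈
        {D | D ∈ admissibleVacuumData X ∧ ∀ x ∉ K ∪ AFEnd.breatheCore e₁ z₀ 1, AgreeAt D d x} := by
    intro c
    refine ⟨AFEnd.breatheQuad_mem_admissibleVacuumData B F hFadm c, fun x hx ↦ ?_⟩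
    rw [mem_union, not_or] at hx
    obtain ⟨h1, h2'⟩ := AFEnd.breatheFamily_eq_of_not_mem_core B (F (EuclideanSpace.single 0 ((c 0) ^ 2))) (c 0) hx.2
    obtain ⟨h3', h4⟩ := hagree (EuclideanSpace.single 0 ((c 0) ^ 2)) x hx.1
    exact ⟨h1.trans h3', h2'.trans h4⟩
  have hε'' : 0 < min 1 ε := lt_min one_pos hε
  have hsettled : ∀ c : EuclideanSpace ℝ (Fin 1), c ≠ 0 → ‖c‖ < min 1 ε →
      Settled (AFEnd.breatheFamily B (F (EuclideanSpace.single 0 ((c 0) ^ 2))) (c 0)) := by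
    intro c hc hcε
    have hρ0 : (EuclideanSpace.single 0 ((c 0) ^ 2) : EuclideanSpace ℝ (Fin 1)) ≠ 0 :=
      InitialDataSet.quadAxis_ne_zero hc
    have hρε : ‖(EuclideanSpace.single 0 ((c 0) ^ 2) : EuclideanSpace ℝ (Fin 1))‖ < ε :=
      (norm_quadAxis_le' (hcε.le.trans (min_le_left _ _))).trans_lt (hcε.trans_le (min_le_right _ _))
    exact summit_breatheFamily B _ (c 0) (hgood _ hρ0 hρε)
  obtain ⟨F', hF't, hF'0, -, hF'i, hF'mem, hF'good⟩ :=
    InitialDataSet.exists_tameCurve_of_localWindow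
      (𝓓 := {D | D ∈ admissibleVacuumData X ∧ ∀ x ∉ K ∪ AFEnd.breatheCore e₁ z₀ 1, AgreeAt D d x})
      (P := fun D : InitialDataSet (𝓡 3) X ↦ Settled D) h2 h3 hε'' (fun c _ ↦ hmem c) (fun c hc hcε ↦ hsettled c hc hcε)
  exact ⟨e₁.restrict hR₂.le, F', hF't, hF'i, hF'0.trans ((AFEnd.breatheQuad_zero B F).trans hF0),
    fun c ↦ (hF'mem c).1, ⟨K ∪ AFEnd.breatheCore e₁ z₀ 1, hK', fun c x hx ↦ (hF'mem c).2 x hx⟩, 1, one_pos,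
    fun c hc _ ↦ hF'good c hc⟩

end Upgrade

/-- **Compact settled tame access from the two SMOOTH COMPACT exits + MGHD existence** (landed as the registered glue
`…CensorshipAlongKerrEnds.compactSettledTameAccess_of_smoothCompactExits`, p167746; in-skeleton proof over the copy
`exists_compactSettledAccess_of_smooth'` and the landed `stub_compactSettledBreathing` p166170, case split on the base).
[folklore] -/
theorem compactSettledTameAccess_of_smooth_exits (hM : MGHDExists) (hN : SmoothCompactNakedExit)
    (hT : SmoothCompactCensoredExit) : CompactSettledTameAccess := by
  intro X _ _ _ _ _ _ d hd
  have hex : ∃ 𝒟 : VacuumCauchyDevelopment d, 𝒟.IsMaximal := hM X d hd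
  by_cases hC : ∀ 𝒟 : VacuumCauchyDevelopment d, 𝒟.IsMaximal →
      Summit.FinalStateConjecture.HasCompleteNullInfinity 𝒟.toCauchyDevelopment
  · by_cases hS : ∀ 𝒟 : VacuumCauchyDevelopment d, 𝒟.IsMaximal →
        ∃ (O : Set 𝒟.carrier) (dd : FinalStateDecomposition 𝒟.toSpacetime O 2),
          (∀ i, Kerr.IsSubextremal (dd.mass i) (dd.spin i)) ∧
            O = Summit.FinalStateConjecture.exteriorOf 𝒟.toCauchyDevelopment dd.charted ∧
              Summit.FinalStateConjecture.RaysStayInClosure 𝒟.toCauchyDevelopment O ∧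
                Summit.FinalStateConjecture.HasExhaustiveCharts dd ∧
                  Summit.FinalStateConjecture.IsFutureOriented dd
    · obtain ⟨e, G, hGt, hGi, hG0, hGadm, hGcpt, hGs⟩ :=
        Summit.FinalStateConjecture.FinalStateConjecture.Theorems.ExactKerrEnds.CensorshipAlongKerrEnds.stub_compactSettledBreathing
          X d hd ⟨hex, fun 𝒟 h𝒟 ↦ ⟨hC 𝒟 h𝒟, hS 𝒟 h𝒟⟩⟩
      exact ⟨e, G, hGt, hGi, hG0, hGadm, hGcpt, 1, one_pos, fun c _ _ ↦ hGs c⟩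
    · push Not at hS
      obtain ⟨𝒟, h𝒟, hno⟩ := hS
      obtain ⟨F, hF, hF0, hFadm, ⟨K, hK, hKF⟩, ε, hε, hgood⟩ :=
        hT X d hd hex hC ⟨𝒟, h𝒟, fun ⟨O, dd, h1, h2, h3, h4, h5⟩ ↦ hno O dd h1 h2 h3 h4 h5⟩
      exact exists_compactSettledAccess_of_smooth' hd hF hF0 hFadm hK hKF hε hgood
  · push Not at hC
    obtain ⟨𝒟, h𝒟, hno⟩ := hC
    obtain ⟨F, hF, hF0, hFadm, ⟨K, hK, hKF⟩, ε, hε, hgood⟩ := hN X d hd ⟨𝒟, h𝒟, hno⟩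
    exact exists_compactSettledAccess_of_smooth' hd hF hF0 hFadm hK hKF hε hgood

/-- **The v4 core from the fixed-datum atom**: radius-indexed receding gluing of `G 0` (from the curve-indexed atom by
`stub_radialOfCurve`) patched along the compactly supported family (`stub_patchAlongCompactFamily`). PROVED
(composition of the two stub shapes). [folklore] -/
theorem gluingAlongCompactFamily_of_radial_patch (hrad : RadialKerrGluing) (hpatch : PatchAlongCompactFamily) :
    GluingAlongCompactFamily := by
  intro X _ _ _ _ _ _ _ e G Mf hGt hGadm hMf hDR hcpt hpos
  have hsole : e.IsSoleEnd := hGt.2.1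
  obtain ⟨Rstar, m, Gh, hRstar, hm, hmM, hGh, hmem, hw⟩ := hrad X (G 0) (hGadm 0) e (Mf 0) hsole hpos (hDR 0)
  exact hpatch X e G Mf hGt hGadm hMf hDR hcpt ⟨Rstar, m, Gh, hRstar, hm, hmM, hGh, hmem, hw⟩

/-- **The full v4.2 transfer in short forms**, PROVED. -/
theorem censorshipAlongKerrEnds_of_compact_architecture (hW : WindowUpgrade) (hsel : RecedingSelection)
    (hM : MGHDExists) (hN : SmoothCompactNakedExit) (hT : SmoothCompactCensoredExit)
    (hcurve : MatchedKerrGluingCurve) (hradOf : MatchedKerrGluingCurve → RadialKerrGluing)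
    (hpatch : PatchAlongCompactFamily) (habs : ReEndingAbsorptionC)
    (hK : NonposMassKerrEnded) (hC : NonposMassCensored) : C₁ :=
  censorshipAlongKerrEnds_of_compact_transplant hW (compactSettledTameAccess_of_smooth_exits hM hN hT)
    (gluingAlongCompactFamily_of_radial_patch (hradOf hcurve) hpatch) hsel habs hK hC

/-! ## §6 Registered stubs (the only `sorry`s of the file), stated EXPANDED over importable declarations (no `let`, no
decl of this file: the registry cuts signatures at the first `:=`), each definitionally its short form. -/

/-- **Stub `stub_windowUpgrade` — WINDOW UPGRADE.** LANDED (first lead): p148379. [cite: Christodoulou1999, p. A24] -/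
theorem stub_windowUpgrade :
    ∀ (X : Type) [TopologicalSpace X] [ChartedSpace Literature.Geometry.Lorentzian.E3 X] [IsManifold (𝓡 3) ((⊤ : ℕ∞) : WithTop ℕ∞) X] [T2Space X] [SecondCountableTopology X] [ConnectedSpace X], ∀ (P : Literature.Geometry.Lorentzian.InitialDataSet (𝓡 3) X → Prop) (e : Literature.Geometry.Lorentzian.AFEnd X) (F : EuclideanSpace ℝ (Fin 1) → Literature.Geometry.Lorentzian.InitialDataSet (𝓡 3) X), Literature.Geometry.Lorentzian.InitialDataSet.IsTameDataFamily e 1 F → Literature.Geometry.Lorentzian.InitialDataSet.IsImmersedAtZero 1 F → (∃ ε > (0 : ℝ), ∀ c, c ≠ 0 → ‖c‖ < ε → P (F c)) → ∃ F' : EuclideanSpace ℝ (Fin 1) → Literature.Geometry.Lorentzian.InitialDataSet (𝓡 3) X, Literature.Geometry.Lorentzian.InitialDataSet.IsTameDataFamily e 1 F' ∧ F' 0 = F 0 ∧ Function.Injective F' ∧ Literature.Geometry.Lorentzian.InitialDataSet.IsImmersedAtZero 1 F' ∧ ∀ c ≠ 0, P (F' c) :=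
  Summit.FinalStateConjecture.FinalStateConjecture.Theorems.ExactKerrEnds.CensorshipAlongKerrEnds.stub_windowUpgrade

/-- **Stub `stub_recedingSelection` — RECEDING SELECTION (bookkeeping).** LANDED (lead c1): p153977. [cite: Christodoulou1999, p. A24] -/
theorem stub_recedingSelection :
    ∀ (X : Type) [TopologicalSpace X] [ChartedSpace Literature.Geometry.Lorentzian.E3 X] [IsManifold (𝓡 3) ((⊤ : ℕ∞) : WithTop ℕ∞) X] [T2Space X] [SecondCountableTopology X] [ConnectedSpace X], ∀ (P : Literature.Geometry.Lorentzian.InitialDataSet (𝓡 3) X → Prop) (e : Literature.Geometry.Lorentzian.AFEnd X) (G : EuclideanSpace ℝ (Fin 1) → Literature.Geometry.Lorentzian.InitialDataSet (𝓡 3) X) (Mf : EuclideanSpace ℝ (Fin 1) → ℝ) (ε Rstar : ℝ) (m : EuclideanSpace ℝ (Fin 1) → ℝ → ℝ) (H : EuclideanSpace ℝ (Fin 1) → ℝ → Literature.Geometry.Lorentzian.InitialDataSet (𝓡 3) X), Literature.Geometry.Lorentzian.InitialDataSet.IsTameDataFamily e 1 G → Literature.Geometry.Lorentzian.InitialDataSet.IsImmersedAtZero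 1 G → Continuous Mf → (∀ c, e.IsStronglyAsymptoticallyFlatDR (G c) (Mf c)) → 0 < ε → e.R < Rstar → (ContinuousOn (fun q : EuclideanSpace ℝ (Fin 1) × ℝ ↦ m q.1 q.2) {q | ‖q.1‖ < ε ∧ Rstar < q.2} ∧ Summit.FinalStateConjecture.FinalStateConjecture.Theorems.SwallowTheDatum.ParametricKerrBurial.SmoothSectionsOn (𝓘(ℝ, EuclideanSpace ℝ (Fin 1)).prod 𝓘(ℝ, ℝ)) (fun q : EuclideanSpace ℝ (Fin 1) × ℝ ↦ H q.1 q.2) {p : (EuclideanSpace ℝ (Fin 1) × ℝ) × X | ‖p.1.1‖ < ε ∧ Rstar < p.1.2} ∧ ∀ (c : EuclideanSpace ℝ (Fin 1)) (R : ℝ), ‖c‖ < ε → Rstar < R → (∀ x ∉ e.far R, Summit.FinalStateConjecture.FinalStateConjecture.Theorems.SwallowTheDatum.ParametricKerrBurial.AgreeAt (H c R) (G c) x) ∧ e.IsStronglyAsymptoticallyFlatDR (H c R) (m c R)) → (∀ η : ℝ, 0 < η → ∃ ε₁ R₁ : ℝ, 0 < ε₁ ∧ ε₁ ≤ ε ∧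 Rstar ≤ R₁ ∧ ∀ (c : EuclideanSpace ℝ (Fin 1)) (R : ℝ), ‖c‖ < ε₁ → R₁ < R → e.wDist (H c R) (G c) < ENNReal.ofReal η ∧ |m c R - Mf c| < η) → (∀ C : Set (EuclideanSpace ℝ (Fin 1)), IsCompact C → (0 : EuclideanSpace ℝ (Fin 1)) ∉ C → C ⊆ Metric.ball (0 : EuclideanSpace ℝ (Fin 1)) ε → ∃ R₂ : ℝ, Rstar ≤ R₂ ∧ ∀ c ∈ C, ∀ R : ℝ, R₂ < R → P (H c R)) → ∃ F' : EuclideanSpace ℝ (Fin 1) → Literature.Geometry.Lorentzian.InitialDataSet (𝓡 3) X, Literature.Geometry.Lorentzian.InitialDataSet.IsTameDataFamily e 1 F' ∧ Literature.Geometry.Lorentzian.InitialDataSet.IsImmersedAtZero 1 F' ∧ F' 0 = G 0 ∧ ∃ ε' > (0 : ℝ), ∀ c, c ≠ 0 → ‖c‖ < ε' → P (F' c) :=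
  Summit.FinalStateConjecture.FinalStateConjecture.Theorems.ExactKerrEnds.CensorshipAlongKerrEnds.stub_recedingSelection

/-- **Stub `stub_smoothCompactNakedExit` — SMOOTH COMPACT NAKED-DATA EXIT** (item stmt-17383 in the weakest witness
form; physics, crux-sized; recommended for PROMOTION). [cite: Christodoulou1999, p. A24] [cite: Christodoulou1999instability, Thm. 4.1] -/
theorem stub_smoothCompactNakedExit : ∀ (X : Type) [TopologicalSpace X] [ChartedSpace Literature.Geometry.Lorentzian.E3 X] [IsManifold (𝓡 3) ((⊤ : ℕ∞) : WithTop ℕ∞) X] [T2Space X] [SecondCountableTopology X] [ConnectedSpace X], ∀ D ∈ Literature.Geometry.Lorentzian.admissibleVacuumData X, (∃ 𝒟 : Literature.Geometry.Lorentzian.VacuumCauchyDevelopment D, 𝒟.IsMaximal ∧ ¬ Summit.FinalStateConjecture.HasCompleteNullInfinity 𝒟.toCauchyDevelopment) → ∃ F : EuclideanSpace ℝ (Fin 1) → Literature.Geometry.Lorentzian.InitialDataSet (𝓡 3) X, Literature.Geometry.Lorentzian.InitialDataSet.IsSmoothDataFamily 1 F ∧ F 0 = D ∧ (∀ c, F c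 ∈ Literature.Geometry.Lorentzian.admissibleVacuumData X) ∧ (∃ K : Set X, IsCompact K ∧ ∀ (c : EuclideanSpace ℝ (Fin 1)) (x : X), x ∉ K → (F c).h.inner x = D.h.inner x ∧ (F c).k x = D.k x) ∧ ∃ ε : ℝ, 0 < ε ∧ ∀ c, c ≠ 0 → ‖c‖ < ε → ((∃ 𝒟 : Literature.Geometry.Lorentzian.VacuumCauchyDevelopment (F c), 𝒟.IsMaximal) ∧ ∀ 𝒟 : Literature.Geometry.Lorentzian.VacuumCauchyDevelopment (F c), 𝒟.IsMaximal → Summit.FinalStateConjecture.HasCompleteNullInfinity 𝒟.toCauchyDevelopment ∧ ∃ (O : Set 𝒟.carrier) (dd : Literature.Geometry.Lorentzian.FinalStateDecomposition 𝒟.toSpacetime O 2), (∀ i, Literature.Geometry.Lorentzian.Kerr.IsSubextremal (dd.mass i) (dd.spin i)) ∧ O = Summit.FinalStateConjecture.exteriorOf 𝒟.toCauchyDevelopment dd.charted ∧ Summit.FinalStateConjecture.RaysStayInClosure 𝒟.toCauchyDevelopment O ∧ Summit.FinalStateConjecture.HasExhaustiveCharts dd ∧ Summit.FinalStateConjecture.IsFutureOriented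 dd) := by
  sorry

/-- **Stub `stub_smoothCompactCensoredExit` — SMOOTH COMPACT CENSORED-DATA EXIT** (item stmt-17348 in the weakest witness
form; physics, crux-sized; recommended for PROMOTION). [cite: DafermosLuk2017, Conjecture 1] [cite: Christodoulou1999, p. A24] -/
theorem stub_smoothCompactCensoredExit : ∀ (X : Type) [TopologicalSpace X] [ChartedSpace Literature.Geometry.Lorentzian.E3 X] [IsManifold (𝓡 3) ((⊤ : ℕ∞) : WithTop ℕ∞) X] [T2Space X] [SecondCountableTopology X] [ConnectedSpace X], ∀ D ∈ Literature.Geometry.Lorentzian.admissibleVacuumData X, (∃ 𝒟 : Literature.Geometry.Lorentzian.VacuumCauchyDevelopment D, 𝒟.IsMaximal) → (∀ 𝒟 : Literature.Geometry.Lorentzian.VacuumCauchyDevelopment D, 𝒟.IsMaximal → Summit.FinalStateConjecture.HasCompleteNullInfinity 𝒟.toCauchyDevelopment) → (∃ 𝒟 : Literature.Geometry.Lorentzian.VacuumCauchyDevelopment D, 𝒟.IsMaximal ∧ ¬ ∃ (O : Set 𝒟.carrier) (dd : Literature.Geometry.Lorentzian.FinalStateDecomposition 𝒟.toSpacetime O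 2), (∀ i, Literature.Geometry.Lorentzian.Kerr.IsSubextremal (dd.mass i) (dd.spin i)) ∧ O = Summit.FinalStateConjecture.exteriorOf 𝒟.toCauchyDevelopment dd.charted ∧ Summit.FinalStateConjecture.RaysStayInClosure 𝒟.toCauchyDevelopment O ∧ Summit.FinalStateConjecture.HasExhaustiveCharts dd ∧ Summit.FinalStateConjecture.IsFutureOriented dd) → ∃ F : EuclideanSpace ℝ (Fin 1) → Literature.Geometry.Lorentzian.InitialDataSet (𝓡 3) X, Literature.Geometry.Lorentzian.InitialDataSet.IsSmoothDataFamily 1 F ∧ F 0 = D ∧ (∀ c, F c ∈ Literature.Geometry.Lorentzian.admissibleVacuumData X) ∧ (∃ K : Set X, IsCompact K ∧ ∀ (c : EuclideanSpace ℝ (Fin 1)) (x : X), x ∉ K → (F c).h.inner x = D.h.inner x ∧ (F c).k x = D.k x) ∧ ∃ ε : ℝ, 0 < ε ∧ ∀ c, c ≠ 0 → ‖c‖ < ε → ((∃ 𝒟 : Literature.Geometry.Lorentzian.VacuumCauchyDevelopment (F c), 𝒟.IsMaximal) ∧ ∀ 𝒟 : Literature.Geometry.Lorentzian.VacuumCauchyDevelopment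 (F c), 𝒟.IsMaximal → Summit.FinalStateConjecture.HasCompleteNullInfinity 𝒟.toCauchyDevelopment ∧ ∃ (O : Set 𝒟.carrier) (dd : Literature.Geometry.Lorentzian.FinalStateDecomposition 𝒟.toSpacetime O 2), (∀ i, Literature.Geometry.Lorentzian.Kerr.IsSubextremal (dd.mass i) (dd.spin i)) ∧ O = Summit.FinalStateConjecture.exteriorOf 𝒟.toCauchyDevelopment dd.charted ∧ Summit.FinalStateConjecture.RaysStayInClosure 𝒟.toCauchyDevelopment O ∧ Summit.FinalStateConjecture.HasExhaustiveCharts dd ∧ Summit.FinalStateConjecture.IsFutureOriented dd) := by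
  sorry

/-- **Stub `stub_matchedKerrGluingCurve` — the sibling crux E's fixed-datum atom S1♭ VERBATIM** (XL analysis;
matched exterior Kerr gluing with smooth dependence on the gluing radius; shared with crux E stmt-18522).
[cite: CorvinoSchoen2006, Thm. 4] [cite: ChruscielDelay2003, Thm. 8.1] [cite: MaoOhTao2023, Thm. 1.3] -/
theorem stub_matchedKerrGluingCurve : ∀ (X : Type) [TopologicalSpace X] [ChartedSpace Literature.Geometry.Lorentzian.E3 X] [IsManifold (𝓡 3) ((⊤ : ℕ∞) : WithTop ℕ∞) X] [T2Space X] [SecondCountableTopology X] [ConnectedSpace X], ∀ [Literature.Geometry.Lorentzian.Kerr.Facts], ∀ d ∈ Literature.Geometry.Lorentzian.admissibleVacuumData X, ∀ (e : Literature.Geometry.Lorentzian.AFEnd X) (M : ℝ), e.IsSoleEnd → 0 < M → e.IsStronglyAsymptoticallyFlatDR d M → ∃ (sstar : ℝ) (ρ m : ℝ → ℝ) (G : ℝ → Literature.Geometry.Lorentzian.InitialDataSet (𝓡 3) X), Filter.Tendsto ρ Filter.atTop Filter.atTop ∧ ContinuousOn m (Set.Ioi sstar) ∧ Filter.Tendsto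 m Filter.atTop (nhds M) ∧ Summit.FinalStateConjecture.FinalStateConjecture.Theorems.SwallowTheDatum.ParametricKerrBurial.SmoothSectionsOn 𝓘(ℝ, ℝ) G {p : ℝ × X | sstar < p.1} ∧ (∀ s : ℝ, sstar < s → G s ∈ Literature.Geometry.Lorentzian.admissibleVacuumData X ∧ (∀ x ∉ e.far (ρ s), Summit.FinalStateConjecture.FinalStateConjecture.Theorems.SwallowTheDatum.ParametricKerrBurial.AgreeAt (G s) d x) ∧ e.IsStronglyAsymptoticallyFlatDR (G s) (m s) ∧ (G s).HasExactKerrEnd) ∧ Filter.Tendsto (fun s ↦ e.wDist (G s) d) Filter.atTop (nhds 0) := by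
  sorry

/-- **Stub `stub_radialOfCurve` — curve-indexed ⟹ radius-indexed receding gluing** (bookkeeping). LANDED (lead c4, wave 1
worker): p166340, `Theorems/ExactKerrEndsCensorshipAlongKerrEndsRadialOfCurve.lean`. [folklore] -/
theorem stub_radialOfCurve : (∀ (X : Type) [TopologicalSpace X] [ChartedSpace Literature.Geometry.Lorentzian.E3 X] [IsManifold (𝓡 3) ((⊤ : ℕ∞) : WithTop ℕ∞) X] [T2Space X] [SecondCountableTopology X] [ConnectedSpace X], ∀ [Literature.Geometry.Lorentzian.Kerr.Facts], ∀ d ∈ Literature.Geometry.Lorentzian.admissibleVacuumData X, ∀ (e : Literature.Geometry.Lorentzian.AFEnd X) (M : ℝ), e.IsSoleEnd → 0 < M → e.IsStronglyAsymptoticallyFlatDR d M → ∃ (sstar : ℝ) (ρ m : ℝ → ℝ) (G : ℝ → Literature.Geometry.Lorentzian.InitialDataSet (𝓡 3) X), Filter.Tendsto ρ Filter.atTop Filter.atTop ∧ ContinuousOn m (Set.Ioi sstar) ∧ Filter.Tendsto m Filter.atTop (nhds M) ∧ Summit.FinalStateConjecture.FinalStateConjecture.Theorems.SwallowTheDatum.ParametricKerrBurial.SmoothSectionsOn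 𝓘(ℝ, ℝ) G {p : ℝ × X | sstar < p.1} ∧ (∀ s : ℝ, sstar < s → G s ∈ Literature.Geometry.Lorentzian.admissibleVacuumData X ∧ (∀ x ∉ e.far (ρ s), Summit.FinalStateConjecture.FinalStateConjecture.Theorems.SwallowTheDatum.ParametricKerrBurial.AgreeAt (G s) d x) ∧ e.IsStronglyAsymptoticallyFlatDR (G s) (m s) ∧ (G s).HasExactKerrEnd) ∧ Filter.Tendsto (fun s ↦ e.wDist (G s) d) Filter.atTop (nhds 0)) → ∀ (X : Type) [TopologicalSpace X] [ChartedSpace Literature.Geometry.Lorentzian.E3 X] [IsManifold (𝓡 3) ((⊤ : ℕ∞) : WithTop ℕ∞) X] [T2Space X] [SecondCountableTopology X] [ConnectedSpace X], ∀ [Literature.Geometry.Lorentzian.Kerr.Facts], ∀ d ∈ Literature.Geometry.Lorentzian.admissibleVacuumData X, ∀ (e : Literature.Geometry.Lorentzian.AFEnd X) (M : ℝ), e.IsSoleEnd → 0 < M → e.IsStronglyAsymptoticallyFlatDR d M → ∃ (Rstar : ℝ) (m : ℝ → ℝ) (G : ℝ → Literature.Geometry.Lorentzian.InitialDataSet (𝓡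 3) X), e.R < Rstar ∧ ContinuousOn m (Set.Ioi Rstar) ∧ Filter.Tendsto m Filter.atTop (nhds M) ∧ Summit.FinalStateConjecture.FinalStateConjecture.Theorems.SwallowTheDatum.ParametricKerrBurial.SmoothSectionsOn 𝓘(ℝ, ℝ) G {p : ℝ × X | Rstar < p.1} ∧ (∀ R : ℝ, Rstar < R → G R ∈ Literature.Geometry.Lorentzian.admissibleVacuumData X ∧ (∀ x ∉ e.far R, Summit.FinalStateConjecture.FinalStateConjecture.Theorems.SwallowTheDatum.ParametricKerrBurial.AgreeAt (G R) d x) ∧ e.IsStronglyAsymptoticallyFlatDR (G R) (m R) ∧ (G R).HasExactKerrEnd) ∧ Filter.Tendsto (fun R ↦ e.wDist (G R) d) Filter.atTop (nhds 0) :=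
  Summit.FinalStateConjecture.FinalStateConjecture.Theorems.ExactKerrEnds.CensorshipAlongKerrEnds.stub_radialOfCurve

/-- **Stub `stub_patchAlongCompactFamily` — THE PATCH** (bookkeeping; held by the lead). LANDED (lead c4): p166625,
`Theorems/ExactKerrEndsCensorshipAlongKerrEndsPatchAlongCompactFamily.lean`. [cite: Corvino2000, §4] -/
theorem stub_patchAlongCompactFamily : ∀ (X : Type) [TopologicalSpace X] [ChartedSpace Literature.Geometry.Lorentzian.E3 X] [IsManifold (𝓡 3) ((⊤ : ℕ∞) : WithTop ℕ∞) X] [T2Space X] [SecondCountableTopology X] [ConnectedSpace X], ∀ (e : Literature.Geometry.Lorentzian.AFEnd X) (G : EuclideanSpace ℝ (Fin 1) → Literature.Geometry.Lorentzian.InitialDataSet (𝓡 3) X) (Mf : EuclideanSpace ℝ (Fin 1) → ℝ), Literature.Geometry.Lorentzian.InitialDataSet.IsTameDataFamily e 1 G → (∀ c, G c ∈ Literature.Geometry.Lorentzian.admissibleVacuumData X) → Continuous Mf → (∀ c, e.IsStronglyAsymptoticallyFlatDR (G c) (Mf c)) → (∃ K : Set X, IsCompact K ∧ ∀ (c : EuclideanSpace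 ℝ (Fin 1)) (x : X), x ∉ K → Summit.FinalStateConjecture.FinalStateConjecture.Theorems.SwallowTheDatum.ParametricKerrBurial.AgreeAt (G c) (G 0) x) → (∃ (Rstar : ℝ) (m : ℝ → ℝ) (Gh : ℝ → Literature.Geometry.Lorentzian.InitialDataSet (𝓡 3) X), e.R < Rstar ∧ ContinuousOn m (Set.Ioi Rstar) ∧ Filter.Tendsto m Filter.atTop (nhds (Mf 0)) ∧ Summit.FinalStateConjecture.FinalStateConjecture.Theorems.SwallowTheDatum.ParametricKerrBurial.SmoothSectionsOn 𝓘(ℝ, ℝ) Gh {p : ℝ × X | Rstar < p.1} ∧ (∀ R : ℝ, Rstar < R → Gh R ∈ Literature.Geometry.Lorentzian.admissibleVacuumData X ∧ (∀ x ∉ e.far R, Summit.FinalStateConjecture.FinalStateConjecture.Theorems.SwallowTheDatum.ParametricKerrBurial.AgreeAt (Gh R) (G 0) x) ∧ e.IsStronglyAsymptoticallyFlatDR (Gh R) (m R) ∧ (Gh R).HasExactKerrEnd) ∧ Filter.Tendsto (fun R ↦ e.wDist (Gh R) (G 0)) Filter.atTop (nhds 0)) → ∃ (ε Rstar : ℝ)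 (m : EuclideanSpace ℝ (Fin 1) → ℝ → ℝ) (H : EuclideanSpace ℝ (Fin 1) → ℝ → Literature.Geometry.Lorentzian.InitialDataSet (𝓡 3) X), 0 < ε ∧ e.R < Rstar ∧ Summit.FinalStateConjecture.FinalStateConjecture.Theorems.ExactKerrEnds.GluedStructure e G ε Rstar m H ∧ (∀ (c : EuclideanSpace ℝ (Fin 1)) (R : ℝ), ‖c‖ < ε → Rstar < R → H c R ∈ Literature.Geometry.Lorentzian.admissibleVacuumData X ∧ (H c R).HasExactKerrEnd) ∧ (∀ (c c' : EuclideanSpace ℝ (Fin 1)) (R : ℝ), ∀ x ∈ e.far Rstar, Summit.FinalStateConjecture.FinalStateConjecture.Theorems.SwallowTheDatum.ParametricKerrBurial.AgreeAt (H c R) (H c' R) x) ∧ (∀ c : EuclideanSpace ℝ (Fin 1), ‖c‖ < ε → Filter.Tendsto (fun R ↦ e.wDist (H c R) (G c)) Filter.atTop (nhds 0)) ∧ Summit.FinalStateConjecture.FinalStateConjecture.Theorems.ExactKerrEnds.JointConvergence e G Mf ε Rstar m H ∧ Summit.FinalStateConjecture.FinalStateConjecture.Theorems.ExactKerrEnds.UniformBound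 e G ε Rstar H :=
  Summit.FinalStateConjecture.FinalStateConjecture.Theorems.ExactKerrEnds.CensorshipAlongKerrEnds.stub_patchAlongCompactFamily

/-- **Stub `stub_reEndingAbsorptionC` — RE-ENDING ABSORPTION, compact architecture** (OPEN physics; the hardest
stub, held by the lead). [cite: KlainermanSzeftel2023, Thm. 1.1] [cite: KlainermanNicolo2003, Thm. 3.7.1]
[cite: DafermosLuk2017, Conjecture 1] -/
theorem stub_reEndingAbsorptionC : ∀ (X : Type) [TopologicalSpace X] [ChartedSpace Literature.Geometry.Lorentzian.E3 X] [IsManifold (𝓡 3) ((⊤ : ℕ∞) : WithTop ℕ∞) X] [T2Space X] [SecondCountableTopology X] [ConnectedSpace X], ∀ [Literature.Geometry.Lorentzian.Kerr.Facts], ∀ (e : Literature.Geometry.Lorentzian.AFEnd X) (G : EuclideanSpace ℝ (Fin 1) → Literature.Geometry.Lorentzian.InitialDataSet (𝓡 3) X) (Mf : EuclideanSpace ℝ (Fin 1) → ℝ) (ε Rstar : ℝ) (m : EuclideanSpace ℝ (Fin 1) → ℝ → ℝ) (H : EuclideanSpace ℝ (Fin 1) → ℝ → Literature.Geometry.Lorentzian.InitialDataSet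 (𝓡 3) X), Literature.Geometry.Lorentzian.InitialDataSet.IsTameDataFamily e 1 G → (∀ c, G c ∈ Literature.Geometry.Lorentzian.admissibleVacuumData X) → Continuous Mf → (∀ c, e.IsStronglyAsymptoticallyFlatDR (G c) (Mf c)) → (∃ K : Set X, IsCompact K ∧ ∀ (c : EuclideanSpace ℝ (Fin 1)) (x : X), x ∉ K → Summit.FinalStateConjecture.FinalStateConjecture.Theorems.SwallowTheDatum.ParametricKerrBurial.AgreeAt (G c) (G 0) x) → 0 < ε → e.R < Rstar → (∀ c : EuclideanSpace ℝ (Fin 1), c ≠ 0 → ‖c‖ < ε → (∃ 𝒟 : Literature.Geometry.Lorentzian.VacuumCauchyDevelopment (G c), 𝒟.IsMaximal) ∧ ∀ 𝒟 : Literature.Geometry.Lorentzian.VacuumCauchyDevelopment (G c), 𝒟.IsMaximal → Summit.FinalStateConjecture.HasCompleteNullInfinity 𝒟.toCauchyDevelopment ∧ ∃ (O : Set 𝒟.carrier) (d : Literature.Geometry.Lorentzian.FinalStateDecomposition 𝒟.toSpacetime O 2), (∀ i, Literature.Geometry.Lorentzian.Kerr.IsSubextremal (d.mass i) (d.spin i))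 ∧ O = Summit.FinalStateConjecture.exteriorOf 𝒟.toCauchyDevelopment d.charted ∧ Summit.FinalStateConjecture.RaysStayInClosure 𝒟.toCauchyDevelopment O ∧ Summit.FinalStateConjecture.HasExhaustiveCharts d ∧ Summit.FinalStateConjecture.IsFutureOriented d) → Summit.FinalStateConjecture.FinalStateConjecture.Theorems.ExactKerrEnds.GluedStructure e G ε Rstar m H → (∀ (c : EuclideanSpace ℝ (Fin 1)) (R : ℝ), ‖c‖ < ε → Rstar < R → H c R ∈ Literature.Geometry.Lorentzian.admissibleVacuumData X ∧ (H c R).HasExactKerrEnd) → (∀ (c c' : EuclideanSpace ℝ (Fin 1)) (R : ℝ), ∀ x ∈ e.far Rstar, Summit.FinalStateConjecture.FinalStateConjecture.Theorems.SwallowTheDatum.ParametricKerrBurial.AgreeAt (H c R) (H c' R) x) → (∀ c : EuclideanSpace ℝ (Fin 1), ‖c‖ < ε → Filter.Tendsto (fun R ↦ e.wDist (H c R) (G c)) Filter.atTop (nhds 0)) → Summit.FinalStateConjecture.FinalStateConjecture.Theorems.ExactKerrEnds.JointConvergence e G Mf ε Rstar m H → Summit.FinalStateConjecture.FinalStateConjecture.Theorems.ExactKerrEnds.UniformBound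 e G ε Rstar H → Summit.FinalStateConjecture.FinalStateConjecture.Theorems.ExactKerrEnds.EventuallyOnBands (fun D ↦ ∀ 𝒟 : Literature.Geometry.Lorentzian.VacuumCauchyDevelopment D, 𝒟.IsMaximal → Summit.FinalStateConjecture.HasCompleteNullInfinity 𝒟.toCauchyDevelopment) ε Rstar H := by
  sorry

/-! ### The stubs under the registry's names, as short forms -/
namespace Goal

/-- Statement of `stub_windowUpgrade` (short form). -/
abbrev stub_windowUpgrade : Prop := WindowUpgrade
/-- Statement of `stub_recedingSelection` (short form). -/
abbrev stub_recedingSelection : Prop := RecedingSelection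
/-- Statement of `stub_smoothCompactNakedExit` (short form). -/
abbrev stub_smoothCompactNakedExit : Prop := SmoothCompactNakedExit
/-- Statement of `stub_smoothCompactCensoredExit` (short form). -/
abbrev stub_smoothCompactCensoredExit : Prop := SmoothCompactCensoredExit
/-- Statement of `stub_matchedKerrGluingCurve` (short form). -/
abbrev stub_matchedKerrGluingCurve : Prop := MatchedKerrGluingCurve
/-- Statement of `stub_radialOfCurve` (short form). -/
abbrev stub_radialOfCurve : Prop := MatchedKerrGluingCurve → RadialKerrGluing
/-- Statement of `stub_patchAlongCompactFamily` (short form). -/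
abbrev stub_patchAlongCompactFamily : Prop := PatchAlongCompactFamily
/-- Statement of `stub_reEndingAbsorptionC` (short form). -/
abbrev stub_reEndingAbsorptionC : Prop := ReEndingAbsorptionC

end Goal

/-- Stub `stub_windowUpgrade` IS its short form. [folklore] -/
theorem windowUpgrade_holds : Goal.stub_windowUpgrade := stub_windowUpgrade
/-- Stub `stub_recedingSelection` IS its short form. [folklore] -/
theorem recedingSelection_holds : Goal.stub_recedingSelection := stub_recedingSelection
/-- Stub `stub_smoothCompactNakedExit` IS its short form. [folklore] -/
theorem smoothCompactNakedExit_holds : Goal.stub_smoothCompactNakedExit := stub_smoothCompactNakedExit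
/-- Stub `stub_smoothCompactCensoredExit` IS its short form. [folklore] -/
theorem smoothCompactCensoredExit_holds : Goal.stub_smoothCompactCensoredExit := stub_smoothCompactCensoredExit
/-- Stub `stub_matchedKerrGluingCurve` IS its short form. [folklore] -/
theorem matchedKerrGluingCurve_holds : Goal.stub_matchedKerrGluingCurve := stub_matchedKerrGluingCurve
/-- Stub `stub_radialOfCurve` IS its short form (LANDED). [folklore] -/
theorem radialOfCurve_holds : Goal.stub_radialOfCurve := stub_radialOfCurve
/-- Stub `stub_patchAlongCompactFamily` IS its short form (LANDED). [folklore] -/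
theorem patchAlongCompactFamily_holds : Goal.stub_patchAlongCompactFamily := stub_patchAlongCompactFamily
/-- Stub `stub_reEndingAbsorptionC` IS its short form. [folklore] -/
theorem reEndingAbsorptionC_holds : Goal.stub_reEndingAbsorptionC := stub_reEndingAbsorptionC

/-! ## §7 The crux BY NAME from the four OPEN registered stubs and three registered items -/

/-- **The v4.2 glue, PROVED in this file** (lands as `Theorems/…CompactOfStubs.lean`, registered sub-goal
`censorshipAlongKerrEnds_of_compactStubs` taking compact settled tame access as its first hypothesis): the crux's short form
from the four open stub shapes and the three items, the landed bricks discharged inside. [folklore] -/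
theorem censorshipAlongKerrEnds_of_compact_stubs (hN : Goal.stub_smoothCompactNakedExit)
    (hT : Goal.stub_smoothCompactCensoredExit) (hcurve : Goal.stub_matchedKerrGluingCurve)
    (habs : Goal.stub_reEndingAbsorptionC) (hM : MGHDExists) (hA : AdmissibleMassNonneg)
    (hZ : ZeroMassAdmissibleMinkowskian) : C₁ :=
  censorshipAlongKerrEnds_of_compact_architecture windowUpgrade_holds recedingSelection_holds hM hN hT hcurve
    radialOfCurve_holds patchAlongCompactFamily_holds habs (nonposMassKerrEnded_of_items hA hZ) (nonposMassCensored_of_items hA hZ)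

/-- **The crux BY NAME** (v4.2): FOUR open private stubs — the two SMOOTH COMPACT exits (physics, the summit's settled
exits 17383/17348 in the weakest witness form, for promotion), the sibling crux E's fixed-datum atom S1♭ VERBATIM, and the
compact-architecture absorption (physics) — and THREE items of the summit BY NAME (stmt-9937 `MGHDExists`, stmt-18051
`AdmissibleMassNonneg`, stmt-18053 `ZeroMassAdmissibleMinkowskian`); every bookkeeping stub of the line is LANDED
(p148379, p153977, p166170, p166340, p166625, p167746). -/
theorem CensorshipAlongKerrEnds_of :
    MGHDExists → AdmissibleMassNonneg → ZeroMassAdmissibleMinkowskian →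
      Goal.stub_smoothCompactNakedExit → Goal.stub_smoothCompactCensoredExit →
        Goal.stub_matchedKerrGluingCurve → Goal.stub_reEndingAbsorptionC →
            Summit.FinalStateConjecture.FinalStateConjecture.Theses.ExactKerrEnds.CensorshipAlongKerrEnds :=
  fun hM hA hZ hN hT hcurve habs ↦ censorshipAlongKerrEnds_of_compact_stubs hN hT hcurve habs hM hA hZ

end Summit.FinalStateConjecture.FinalStateConjecture.Cruxes.CensorshipAlongKerrEnds.SketchLine

end
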